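import Summits.BirchSwinnertonDyer.BirchSwinnertonDyer.Theorems.PrintX11aLowerHalfThreeMazurCore
import HarnessLib

/-!
# Crux `X11aLowerHalf` (item stmt-BirchSwinnertonDyer-19064): the composition RE-KEYED on ONE `p ≥ 5` certificate child
# (Greenberg's analytic `μ = 0` on the WHOLE deep X11a locus at `p ≥ 5`, both images) — candidate r16 for the day K2's item 19948 retires
# (width seat bsd-line-er5-p2 = -w3, gen 10; `--supports stmt-BirchSwinnertonDyer-19064` helper; the lead decides and registers, not this seat)

HONEST FRAMING.  Composition theorems only; no definition, no named fact minted, no `sorry`.  Every theorem is CONDITIONAL and closes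
nothing by itself; the residual statements of the line (`hμ5` at `p ≥ 5`, `hMC3` at `p = 3`) stay OPEN and DISPLAYED.  No summit statement
is proved; BSD is proved for no curve and no class.

WHY THIS FILE.  The registered line «birth» r15 of crux L (skeleton 464ffe3b8cde1601, six stubs) types its FOURTH child BY NAME as bsd-stepL's
item 19948 `Theses.ErratumRoadFive.NonSurjCornerTwinMuAn` (analytic `μ = 0` in the allowable-root currency at EVERY non-surjective X11a pair,
`p ∈ {5,7}`, `p ∣ ord_p Δ_min`).  Planner bsd-stepL g42's RULING 69 (a)(ii) + phase 1b re-splits K2's crux `NonSurjCorner` in SHAPE B and RETIRES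
its gen-1 children 19946–19949; the successor child `Theorems.NonSurjCornerTwinMuAnDeep` (p645655) asks `μ = 0` ONLY at the Friedberg–Hoffstein
twin models of DEEP X11b corner pairs — it is TWIST-RESTRICTED and does NOT imply 19948's class-wide X11a text nor its restriction to deep
X11a pairs (the implication goes the other way, K2's `twinMuAnDeep_of_twinMuAn`).  What r15's composition
`Birth.x11aLowerHalf_erratumRoadFive_of_children_r15` (p646859) actually CONSUMES of 19948 is only its merger with the fifth child into the
both-images certificate «`X11a.MuAnZeroAt W p` at every DEEP X11a pair with `p ≥ 5`» (`muAnDeepFive_of_nonSurjCornerTwinMuAn_of_surjDeep hB h48 hS`,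
the lead's p609916-era adapter) — which is VERBATIM the line's r3∕r4 registered text `stub_muAnDeepFive` (Greenberg's Conj. 1.11, analytic
form, on the deep X11a locus at `p ≥ 5`; OPEN class-wide; per pair a finite modular-symbol certificate, 158 ∕ 158 deep surjective pairs with
`N < 5·10⁵` certified, no deep non-surjective pair known in that range).  So the composition can be keyed on that ONE child:
* §1 `Birth.x11aLowerHalf_of_threeDeep_of_muAnDeepFive` — crux L BY NAME, GENERIC in BOTH residual statements (`hμ5` at `p ≥ 5`, `h3` = the lower
  half at the deep `p = 3` pairs supplied by any road); = p646859's `x11aLowerHalf_of_threeDeep_of_children` with the certificate as the binder.  On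
  this road Balakrishnan–Dogra–Müller–Tuitman–Vonk Thm. 1.2 (conjunct 9 of r15's `stub_chainFactsLower`) is NOT consumed (it only routed
  `¬Surj ⟹ p ∈ {5,7}` into 19948), so the chain bundle here has EIGHT conjuncts (`h8L` = r15's nine minus BDMTV, same order);
* §2 candidate **r16-M** («merge»): `Birth.x11aLowerHalf_of_children_r16 h9 h8L hQ3 hμ5 hMC3` — FIVE children: the shared nine (U3's text), the
  EIGHT chain facts, the three partner facts, `hμ5`, `hMC3` (r15's sixth, unchanged) — and its `ErratumRoadFive` spelling; distinct named
  published facts 20 (BDMTV leaves with 19948);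
* §3 candidate **r16-K** («keep the split, deep-restricted»): the fourth child re-cut to 19948's text with `¬ X11a.ShaAnUnit Wd p` inserted
  (`h48D`), fifth and sixth unchanged, chain bundle NINE (BDMTV used): `Birth.muAnDeepFive_of_twinMuAnDeep_of_surjDeep` (K ⟹ M's certificate, modulo
  BDMTV) and `Birth.x11aLowerHalf_of_children_r16K h9 h9L hQ3 h48D hS hMC3` + `ErratumRoadFive` spelling;
* §4 MONOTONICITY (no road lost either way): r15's fourth text ⟹ r16-K's (`nonSurjTwinMuAnDeep_of_nonSurjCornerTwinMuAn`, drop a binder); r15's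
  fourth + fifth ⟹ r16-M's certificate is the tree's `muAnDeepFive_of_nonSurjCornerTwinMuAn_of_surjDeep` (not restated); r16-M's eight chain facts
  are a projection of r15's nine (`chainEight_of_chainNine`).  The r15 statement itself is NOT re-derived here (it is p646859's, `dedup.landed`).
Option (0) — keep r15 and re-home 19948's statement as an input item of route `PrintX11a` — needs no file.  The lead ∕ planners choose; this seat
registers nothing.

References: [GreenbergLNM1716] §1 Conj. 1.11 (p. 61); [GreenbergVatsal2000] pp. 2–3 (μ_anal); [BalakrishnanEtAl2019] Thm. 1.2;
[EmertonPollackWeston2006] Thm. 1, 3.1.1, 5.1.3, Cor. 5.1.4; [Wan2015] Thm. 4; [YanZhu2024MainConjNonCM] Thm. 4.9; [Wuthrich2014] Thm. 3, Cor. 18,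
Lemma 20; [Kato2004Asterisque] Thm. 12.4, §17.13; [SteinWuthrich2013] Thm. 6.1; [Mazur1978] Cor. 4.1; [MazurTateTeitelbaum1986Invent] §I.10, §I.14;
[Skinner2016PacificMC] Thm. A (shape); [Fisher2012Hessian] Thm. 13.2; [Miller2011LMS] Def. 1.1; cell files `Cruxes/X11aLowerHalf/Lines/birth.lean`
(r15), `LEAD-g6-VERDICT.md`, bsd-stepL `plan/RULING69/edit69_1b.json`, `Theorems/ErratumRoadFiveNonSurjCornerDeepChildrenDefs.lean`.
-/

set_option autoImplicit false
set_option linter.dupNamespace false -- the directory name repeats the summit name (sibling precedent)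

noncomputable section

open scoped Classical MatrixGroups ModularForm

open CongruenceSubgroup UpperHalfPlane WeierstrassCurve IsDedekindDomain Rat.HeightOneSpectrum
  Literature.NumberTheory.EllipticCurves
  Literature.NumberTheory.EllipticCurves.ModularForms
  Literature.NumberTheory.EllipticCurves.Rank1Residual
  Literature.NumberTheory.EllipticCurves.Rank1Residual.Typed
  Literature.NumberTheory.EllipticCurves.Wuthrich2014
  Literature.NumberTheory.EllipticCurves.SteinWuthrich2013
  Literature.NumberTheory.EllipticCurves.Greenberg1999
  Literature.NumberTheory.EllipticCurves.Kato2004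
  Literature.NumberTheory.EllipticCurves.GreenbergVatsal2000
  Literature.NumberTheory.EllipticCurves.EmertonPollackWeston2006
  Literature.NumberTheory.EllipticCurves.SkinnerUrban2014
  Literature.NumberTheory.EllipticCurves.BalakrishnanEtAl2019
  Literature.NumberTheory.GaloisRepresentations
  Literature.NumberTheory.Automorphic
  Summit.BirchSwinnertonDyer.Rank1Residual
  Summit.BirchSwinnertonDyer.Rank1Residual.X11a
  Summit.BirchSwinnertonDyer.BirchSwinnertonDyer.Theorems.OddChain

namespace Summit.BirchSwinnertonDyer.BirchSwinnertonDyer.Theorems.Birth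

/-! ### §1 Crux L BY NAME, generic in BOTH residual statements -/

/-- **Crux L BY NAME, GENERIC in the `p ≥ 5` certificate AND in the `p = 3` deep statement**: unit pairs free
(`x11a_missingLowerBoundAt_of_shaAnUnit`); `p = 3` deep ⟵ `h3` (any road); `p ≥ 5` deep ⟵ the both-images certificate `hμ5`
(`X11a.MuAnZeroAt`, Greenberg's analytic `μ = 0`; OPEN class-wide) + X. Wan's rational Thm. 4 at an ordinary member (`h8L.2.2.1`, p ⩾ 5 in
print) + EPW 3.1.1 ∕ Thm. 1 alg ∕ 5.1.3, Deligne–Serre, Hida 3.26, Kato–Wuthrich A32 (surjective image, with Wuthrich's big-image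
propagation) or Kato §17.13 contra + 12.4 + Mazur 4.1 (non-surjective image) — verbatim the r7–r15 body of p646859's
`x11aLowerHalf_of_threeDeep_of_children` with the certificate as the binder.  `h9` = the shared nine (U3's text); `h8L` = the EIGHT chain
facts (r15's nine minus Balakrishnan et al. Thm. 1.2, which this road does not consume).  CONDITIONAL; closes nothing; BSD is not proved.
[cite: GreenbergLNM1716, §1 Conj. 1.11 (p. 61)] [cite: Wan2015, Thm. 4 (pp. 4–5)] [cite: EmertonPollackWeston2006, Thm. 3.1.1, Thm. 1, Thm. 5.1.3]
[cite: Kato2004Asterisque, Thm. 12.4 (p. 221), §17.13 (pp. 279–280)] [cite: Miller2011LMS, Def. 1.1 (arXiv:1010.2431 p. 3)] -/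
theorem x11aLowerHalf_of_threeDeep_of_muAnDeepFive
    (h9 : thm61_splitMultiplicative ∧ thm61_nonsplitMultiplicative ∧
      (∀ (W : WeierstrassCurve ℚ) [W.IsElliptic] [W.IsGloballyMinimal] (p : ℕ) [Fact p.Prime],
        p ≠ 2 → greenberg_stevens (W := W) (p := p)) ∧
      Kato2004.thm12_4 ∧ exists_isNewformOf ∧
      Kato2004.exists_multDivisibilityInputs_nonsplit_contra ∧
      Kato2004.exists_multDivisibilityInputs_split_contra ∧
      Kato2004.exists_multDivisibilityInputs_fine_contra ∧ mazur_not_dvd_maninConstant_of_odd)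
    (h8L : thm311_cotorsion_weightK_member_ofLevel_odd ∧ thm1_muAlg_of_weightK_member_ofLevel_odd ∧
      Wan2015.thm4_rational_weightK_member_of_bdd_ofLevel_irred ∧
      thm513_transfer_from_weightK_member_of_bdd_ofLevel_odd ∧
      DeligneSerre1974.thm61_exists_adicGaloisRep ∧ Hida2000_thm326_ordinary ∧
      kato_charIdeal_dvd_multiplicative_of_surjective ∧
      rank_eq_analyticRank_of_analyticRank_le_one)
    (hμ5 : ∀ (W : WeierstrassCurve ℚ) [W.IsElliptic] [W.IsGloballyMinimal] (p : ℕ) [Fact p.Prime],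
      ClassX11a W p → 5 ≤ p → ¬ X11a.ShaAnUnit W p → X11a.MuAnZeroAt W p)
    (h3 : ∀ (W : WeierstrassCurve ℚ) [W.IsElliptic] [W.IsGloballyMinimal] (p : ℕ) [Fact p.Prime],
      ClassX11a W p → p = 3 → ¬ X11a.ShaAnUnit W p → MissingLowerBoundAt W p) :
    Summit.BirchSwinnertonDyer.BirchSwinnertonDyer.Theses.PrintX11a.X11aLowerHalf := by
  obtain ⟨hJs, hJn, hGS, h12, hNf, hns', hsp', hfine', hMz⟩ := h9
  obtain ⟨h311, hT1a, hT2, hT1b, h61, h326, hKato, hGZK⟩ := h8L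
  intro W _ _ p hpF hX
  by_cases hu : X11a.ShaAnUnit W p
  · exact x11a_missingLowerBoundAt_of_shaAnUnit hu
  by_cases hp3 : p = 3
  · exact h3 W p hX hp3 hu
  · -- `p ≥ 5`: the certificate + Wan's member + the surjective / contra doors (verbatim the r7–r15 body)
    have hp5 : 5 ≤ p := (Fact.out : p.Prime).five_le_of_ne_two_of_ne_three hX.ne_two hp3
    have hμ : X11a.MuAnZeroAt W p := hμ5 W p hX hp5 hu
    obtain ⟨M, _, hpM, k, g, ι, hmem, hRat⟩ := memberRatEqAt_of_wan_of_five_le W p hNf hT2 hp5 hX.mult hX.irr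
    by_cases hsurj : Surj W p
    · have hsurj' : ∀ n : ℕ, W.HasSurjectiveModNGaloisRep (p ^ n : ℕ) :=
        kato_charIdeal_dvd_multiplicative_of_surjective.surjective_pow_of_five_le W p hp5 hsurj
      exact hX.missingLowerBoundAt_of_member_of_ratEq_of_surjective_pow hNf h311 hT1a hT1b h61 h326 hKato hJs hJn hGZK
        (hGS W p hX.ne_two) hsurj' hμ hpM g ι hmem hRat
    · exact hX.missingLowerBoundAt_of_member_of_ratEq_of_not_surj_contra hNf h311 hT1a hT1b h61 h326 h12 hns' hsp' hfine' hMz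
        hJs hJn hGZK (hGS W p hX.ne_two) hsurj hμ hpM g ι hmem hRat

/-! ### §2 Candidate r16-M («merge»): FIVE children, the `p ≥ 5` child = the r3∕r4 registered text `stub_muAnDeepFive` -/

/-- **Crux L BY NAME from FIVE children — candidate r16-M** (for the day item 19948 retires under K2's RULING 69 resplit): the shared nine
`h9` (U3's text), the EIGHT chain facts `h8L`, the three partner facts `hQ3` (EPW Cor. 5.1.4, Yan–Zhu Thm. 4.9, EPW Thm. 1 alg; consumed on
the finite-flat `p = 3` locus only), the both-images certificate `hμ5 : ∀ W p, ClassX11a W p → 5 ≤ p → ¬ X11a.ShaAnUnit W p →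
X11a.MuAnZeroAt W p` (= r4's registered `stub_muAnDeepFive` VERBATIM; OPEN), and r15's sixth child `hMC3` (Mazur's cyclotomic main conjecture
on the très-ramifié deep X11a locus at `3`; OPEN) — `p = 3` through `ThreePartner.lowerThreeDeep_of_partnerFF_of_mazurTR_of_facts` exactly as
in r15.  Skeleton use: `X11aLowerHalf_of := x11aLowerHalf_erratumRoadFive_of_children_r16 stub_nineFactsOddGS stub_chainFactsLower
stub_threePartnerFactsLower stub_muAnDeepFive stub_mazurMCAtTresRamifieThree` (chain stub re-cut to eight conjuncts).  Distinct named published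
facts on such a line: 20.  CONDITIONAL; closes nothing; BSD is not proved.
[cite: GreenbergLNM1716, §1 Conj. 1.11 (p. 61)] [cite: MazurTateTeitelbaum1986Invent, §I.14 (shape only)]
[cite: Skinner2016PacificMC, Thm. A (shape only; printed under (ram))] [cite: Fisher2012Hessian, Thm. 13.2 (n = 3)] [cite: Miller2011LMS, Def. 1.1] -/
theorem x11aLowerHalf_of_children_r16
    (h9 : thm61_splitMultiplicative ∧ thm61_nonsplitMultiplicative ∧
      (∀ (W : WeierstrassCurve ℚ) [W.IsElliptic] [W.IsGloballyMinimal] (p : ℕ) [Fact p.Prime],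
        p ≠ 2 → greenberg_stevens (W := W) (p := p)) ∧
      Kato2004.thm12_4 ∧ exists_isNewformOf ∧
      Kato2004.exists_multDivisibilityInputs_nonsplit_contra ∧
      Kato2004.exists_multDivisibilityInputs_split_contra ∧
      Kato2004.exists_multDivisibilityInputs_fine_contra ∧ mazur_not_dvd_maninConstant_of_odd)
    (h8L : thm311_cotorsion_weightK_member_ofLevel_odd ∧ thm1_muAlg_of_weightK_member_ofLevel_odd ∧
      Wan2015.thm4_rational_weightK_member_of_bdd_ofLevel_irred ∧
      thm513_transfer_from_weightK_member_of_bdd_ofLevel_odd ∧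
      DeligneSerre1974.thm61_exists_adicGaloisRep ∧ Hida2000_thm326_ordinary ∧
      kato_charIdeal_dvd_multiplicative_of_surjective ∧
      rank_eq_analyticRank_of_analyticRank_le_one)
    (hQ3 : cor514_transfer_of_goodOrdinary_odd ∧ YanZhu2026.thm49_charIdeal_eq_padicLFunction ∧
      thm1_muAlg_transfer_goodOrdinary_of_mult_odd)
    (hμ5 : ∀ (W : WeierstrassCurve ℚ) [W.IsElliptic] [W.IsGloballyMinimal] (p : ℕ) [Fact p.Prime],
      ClassX11a W p → 5 ≤ p → ¬ X11a.ShaAnUnit W p → X11a.MuAnZeroAt W p)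
    (hMC3 : ∀ (W : WeierstrassCurve ℚ) [W.IsElliptic] [W.IsGloballyMinimal] (p : ℕ) [Fact p.Prime],
      ClassX11a W p → p = 3 → ¬ X11a.ShaAnUnit W p → ¬ p ∣ padicValInt p W.minimalDiscriminantInt →
      X2.MazurMainConjectureAt W p) :
    Summit.BirchSwinnertonDyer.BirchSwinnertonDyer.Theses.PrintX11a.X11aLowerHalf := by
  obtain ⟨hJs, hJn, hGS, h12, hNf, hns', hsp', hfine', hMz⟩ := h9
  obtain ⟨hEPW, hYZ, hTa⟩ := hQ3
  exact x11aLowerHalf_of_threeDeep_of_muAnDeepFive ⟨hJs, hJn, hGS, h12, hNf, hns', hsp', hfine', hMz⟩ h8L hμ5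
    (ThreePartner.lowerThreeDeep_of_partnerFF_of_mazurTR_of_facts hNf h8L.2.2.2.2.2.2.1 h12 hns' hsp' hfine' hMz hJs hJn
      h8L.2.2.2.2.2.2.2 hGS hEPW hYZ hTa hMC3)

/-- The `ErratumRoadFive` spelling of the five-children composition r16-M (one statement under two route names, `Iff.rfl`) — usable as
the skeleton's `X11aLowerHalf_of`. [cite: Miller2011LMS, Def. 1.1 (arXiv:1010.2431 p. 3)] [cite: GreenbergLNM1716, §1 Conj. 1.11 (p. 61)] -/
theorem x11aLowerHalf_erratumRoadFive_of_children_r16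
    (h9 : thm61_splitMultiplicative ∧ thm61_nonsplitMultiplicative ∧
      (∀ (W : WeierstrassCurve ℚ) [W.IsElliptic] [W.IsGloballyMinimal] (p : ℕ) [Fact p.Prime],
        p ≠ 2 → greenberg_stevens (W := W) (p := p)) ∧
      Kato2004.thm12_4 ∧ exists_isNewformOf ∧
      Kato2004.exists_multDivisibilityInputs_nonsplit_contra ∧
      Kato2004.exists_multDivisibilityInputs_split_contra ∧
      Kato2004.exists_multDivisibilityInputs_fine_contra ∧ mazur_not_dvd_maninConstant_of_odd)
    (h8L : thm311_cotorsion_weightK_member_ofLevel_odd ∧ thm1_muAlg_of_weightK_member_ofLevel_odd ∧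
      Wan2015.thm4_rational_weightK_member_of_bdd_ofLevel_irred ∧
      thm513_transfer_from_weightK_member_of_bdd_ofLevel_odd ∧
      DeligneSerre1974.thm61_exists_adicGaloisRep ∧ Hida2000_thm326_ordinary ∧
      kato_charIdeal_dvd_multiplicative_of_surjective ∧
      rank_eq_analyticRank_of_analyticRank_le_one)
    (hQ3 : cor514_transfer_of_goodOrdinary_odd ∧ YanZhu2026.thm49_charIdeal_eq_padicLFunction ∧
      thm1_muAlg_transfer_goodOrdinary_of_mult_odd)
    (hμ5 : ∀ (W : WeierstrassCurve ℚ) [W.IsElliptic] [W.IsGloballyMinimal] (p : ℕ) [Fact p.Prime],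
      ClassX11a W p → 5 ≤ p → ¬ X11a.ShaAnUnit W p → X11a.MuAnZeroAt W p)
    (hMC3 : ∀ (W : WeierstrassCurve ℚ) [W.IsElliptic] [W.IsGloballyMinimal] (p : ℕ) [Fact p.Prime],
      ClassX11a W p → p = 3 → ¬ X11a.ShaAnUnit W p → ¬ p ∣ padicValInt p W.minimalDiscriminantInt →
      X2.MazurMainConjectureAt W p) :
    Summit.BirchSwinnertonDyer.BirchSwinnertonDyer.Theses.ErratumRoadFive.X11aLowerHalf :=
  x11aLowerHalf_of_children_r16 h9 h8L hQ3 hμ5 hMC3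

/-! ### §3 Candidate r16-K («keep the split»): the fourth child = 19948's text restricted to the DEEP pairs -/

/-- **r16-K's fourth text + the surjective residual ⟹ r16-M's certificate, modulo BDMTV** (pure logic over the tree's adapter
`NonSurjChain.muAnZeroAt_of_allowableRootShape`): at a deep X11a pair with `p ≥ 5`, either `ρ̄` is onto (`hS`) or — by Balakrishnan–Dogra–
Müller–Tuitman–Vonk Thm. 1.2 (`hB`: `p ∈ {5,7}`) and `ClassX11a.surj_of_not_dvd` (`p ∣ ord_p Δ_min`) — the deep-restricted allowable-root text
`h48D` applies.  [cite: BalakrishnanEtAl2019, §1 Thm. 1.2] [cite: GreenbergLNM1716, §1 Conj. 1.11 (p. 61)]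
[cite: MazurTateTeitelbaum1986Invent, §I.10 and §I.14 (allowable root a_p at p ∥ N; shape only)] -/
theorem muAnDeepFive_of_twinMuAnDeep_of_surjDeep (hB : thm12_not_le_normalizer_splitCartan)
    (h48D : ∀ (Wd : WeierstrassCurve ℚ) [Wd.IsElliptic] [Wd.IsGloballyMinimal] (p : ℕ) [Fact p.Prime],
      ClassX11a Wd p → ¬ Surj Wd p → (p = 5 ∨ p = 7) → p ∣ padicValInt p Wd.minimalDiscriminantInt →
      ¬ X11a.ShaAnUnit Wd p →
      ∀ {N : ℕ} [NeZero N] (f : CuspForm (Gamma0 N) 2), IsNewformOf Wd f →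
      ∀ (ϖ : ℚ), (ϖ : ℝ) * Wd.realPeriodRat = plusPeriod f →
      ∀ (a : ℚ_[p]) (L : PowerSeries ℚ_[p]),
        (Wd.HasSplitMultiplicativeReductionAtPrime p → a = 1) →
        (¬ Wd.HasSplitMultiplicativeReductionAtPrime p → a = -1) →
        IsMultPAdicLFunctionOf f p a L →
        ∃ n : ℕ, ‖PowerSeries.coeff n (PowerSeries.C ((ϖ : ℚ) : ℚ_[p]) * L)‖ = 1)
    (hS : ∀ (W : WeierstrassCurve ℚ) [W.IsElliptic] [W.IsGloballyMinimal] (p : ℕ) [Fact p.Prime],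
      ClassX11a W p → 5 ≤ p → Surj W p → ¬ X11a.ShaAnUnit W p → X11a.MuAnZeroAt W p) :
    ∀ (W : WeierstrassCurve ℚ) [W.IsElliptic] [W.IsGloballyMinimal] (p : ℕ) [Fact p.Prime],
      ClassX11a W p → 5 ≤ p → ¬ X11a.ShaAnUnit W p → X11a.MuAnZeroAt W p := by
  intro W _ _ p _ hX hp5 hu
  by_cases hs : Surj W p
  · exact hS W p hX hp5 hs hu
  · have h57 : p = 5 ∨ p = 7 :=
      GaloisImage.eq_five_or_eq_seven_of_mult_of_irr_of_not_surj W p hB hp5 hX.mult hX.irr hs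
    have hdvd : p ∣ padicValInt p W.minimalDiscriminantInt := by
      by_contra hΔ
      exact hs (hX.surj_of_not_dvd W p hΔ)
    exact NonSurjChain.muAnZeroAt_of_allowableRootShape W p
      (fun f hf ϖ hϖ a L h1 h2 hL => h48D W p hX hs h57 hdvd hu f hf ϖ hϖ a L h1 h2 hL)

/-- **Crux L BY NAME from SIX children — candidate r16-K** («keep the split»): r15 with the fourth child re-cut to 19948's allowable-root text
RESTRICTED to the deep pairs (`h48D`: `¬ X11a.ShaAnUnit Wd p` inserted after the discriminant binder); fifth (`hS`), sixth (`hMC3`), the shared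
nine, the NINE chain facts (BDMTV consumed here) and the three partner facts unchanged.  := r16-M's composition fed the merged certificate of
`muAnDeepFive_of_twinMuAnDeep_of_surjDeep` and the first eight chain facts.  CONDITIONAL; closes nothing; BSD is not proved.
[cite: GreenbergLNM1716, §1 Conj. 1.11 (p. 61)] [cite: BalakrishnanEtAl2019, §1 Thm. 1.2] [cite: Miller2011LMS, Def. 1.1] -/
theorem x11aLowerHalf_of_children_r16K
    (h9 : thm61_splitMultiplicative ∧ thm61_nonsplitMultiplicative ∧
      (∀ (W : WeierstrassCurve ℚ) [W.IsElliptic] [W.IsGloballyMinimal] (p : ℕ) [Fact p.Prime],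
        p ≠ 2 → greenberg_stevens (W := W) (p := p)) ∧
      Kato2004.thm12_4 ∧ exists_isNewformOf ∧
      Kato2004.exists_multDivisibilityInputs_nonsplit_contra ∧
      Kato2004.exists_multDivisibilityInputs_split_contra ∧
      Kato2004.exists_multDivisibilityInputs_fine_contra ∧ mazur_not_dvd_maninConstant_of_odd)
    (h9L : thm311_cotorsion_weightK_member_ofLevel_odd ∧ thm1_muAlg_of_weightK_member_ofLevel_odd ∧
      Wan2015.thm4_rational_weightK_member_of_bdd_ofLevel_irred ∧
      thm513_transfer_from_weightK_member_of_bdd_ofLevel_odd ∧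
      DeligneSerre1974.thm61_exists_adicGaloisRep ∧ Hida2000_thm326_ordinary ∧
      kato_charIdeal_dvd_multiplicative_of_surjective ∧
      rank_eq_analyticRank_of_analyticRank_le_one ∧
      thm12_not_le_normalizer_splitCartan)
    (hQ3 : cor514_transfer_of_goodOrdinary_odd ∧ YanZhu2026.thm49_charIdeal_eq_padicLFunction ∧
      thm1_muAlg_transfer_goodOrdinary_of_mult_odd)
    (h48D : ∀ (Wd : WeierstrassCurve ℚ) [Wd.IsElliptic] [Wd.IsGloballyMinimal] (p : ℕ) [Fact p.Prime],
      ClassX11a Wd p → ¬ Surj Wd p → (p = 5 ∨ p = 7) → p ∣ padicValInt p Wd.minimalDiscriminantInt →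
      ¬ X11a.ShaAnUnit Wd p →
      ∀ {N : ℕ} [NeZero N] (f : CuspForm (Gamma0 N) 2), IsNewformOf Wd f →
      ∀ (ϖ : ℚ), (ϖ : ℝ) * Wd.realPeriodRat = plusPeriod f →
      ∀ (a : ℚ_[p]) (L : PowerSeries ℚ_[p]),
        (Wd.HasSplitMultiplicativeReductionAtPrime p → a = 1) →
        (¬ Wd.HasSplitMultiplicativeReductionAtPrime p → a = -1) →
        IsMultPAdicLFunctionOf f p a L →
        ∃ n : ℕ, ‖PowerSeries.coeff n (PowerSeries.C ((ϖ : ℚ) : ℚ_[p]) * L)‖ = 1)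
    (hS : ∀ (W : WeierstrassCurve ℚ) [W.IsElliptic] [W.IsGloballyMinimal] (p : ℕ) [Fact p.Prime],
      ClassX11a W p → 5 ≤ p → Surj W p → ¬ X11a.ShaAnUnit W p → X11a.MuAnZeroAt W p)
    (hMC3 : ∀ (W : WeierstrassCurve ℚ) [W.IsElliptic] [W.IsGloballyMinimal] (p : ℕ) [Fact p.Prime],
      ClassX11a W p → p = 3 → ¬ X11a.ShaAnUnit W p → ¬ p ∣ padicValInt p W.minimalDiscriminantInt →
      X2.MazurMainConjectureAt W p) :
    Summit.BirchSwinnertonDyer.BirchSwinnertonDyer.Theses.PrintX11a.X11aLowerHalf := by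
  obtain ⟨h311, hT1a, hT2, hT1b, h61, h326, hKato, hGZK, hB⟩ := h9L
  exact x11aLowerHalf_of_children_r16 h9 ⟨h311, hT1a, hT2, hT1b, h61, h326, hKato, hGZK⟩ hQ3
    (muAnDeepFive_of_twinMuAnDeep_of_surjDeep hB h48D hS) hMC3

/-- The `ErratumRoadFive` spelling of the six-children composition r16-K. [cite: Miller2011LMS, Def. 1.1 (arXiv:1010.2431 p. 3)]
[cite: GreenbergLNM1716, §1 Conj. 1.11 (p. 61)] -/
theorem x11aLowerHalf_erratumRoadFive_of_children_r16K
    (h9 : thm61_splitMultiplicative ∧ thm61_nonsplitMultiplicative ∧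
      (∀ (W : WeierstrassCurve ℚ) [W.IsElliptic] [W.IsGloballyMinimal] (p : ℕ) [Fact p.Prime],
        p ≠ 2 → greenberg_stevens (W := W) (p := p)) ∧
      Kato2004.thm12_4 ∧ exists_isNewformOf ∧
      Kato2004.exists_multDivisibilityInputs_nonsplit_contra ∧
      Kato2004.exists_multDivisibilityInputs_split_contra ∧
      Kato2004.exists_multDivisibilityInputs_fine_contra ∧ mazur_not_dvd_maninConstant_of_odd)
    (h9L : thm311_cotorsion_weightK_member_ofLevel_odd ∧ thm1_muAlg_of_weightK_member_ofLevel_odd ∧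
      Wan2015.thm4_rational_weightK_member_of_bdd_ofLevel_irred ∧
      thm513_transfer_from_weightK_member_of_bdd_ofLevel_odd ∧
      DeligneSerre1974.thm61_exists_adicGaloisRep ∧ Hida2000_thm326_ordinary ∧
      kato_charIdeal_dvd_multiplicative_of_surjective ∧
      rank_eq_analyticRank_of_analyticRank_le_one ∧
      thm12_not_le_normalizer_splitCartan)
    (hQ3 : cor514_transfer_of_goodOrdinary_odd ∧ YanZhu2026.thm49_charIdeal_eq_padicLFunction ∧
      thm1_muAlg_transfer_goodOrdinary_of_mult_odd)
    (h48D : ∀ (Wd : WeierstrassCurve ℚ) [Wd.IsElliptic] [Wd.IsGloballyMinimal] (p : ℕ) [Fact p.Prime],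
      ClassX11a Wd p → ¬ Surj Wd p → (p = 5 ∨ p = 7) → p ∣ padicValInt p Wd.minimalDiscriminantInt →
      ¬ X11a.ShaAnUnit Wd p →
      ∀ {N : ℕ} [NeZero N] (f : CuspForm (Gamma0 N) 2), IsNewformOf Wd f →
      ∀ (ϖ : ℚ), (ϖ : ℝ) * Wd.realPeriodRat = plusPeriod f →
      ∀ (a : ℚ_[p]) (L : PowerSeries ℚ_[p]),
        (Wd.HasSplitMultiplicativeReductionAtPrime p → a = 1) →
        (¬ Wd.HasSplitMultiplicativeReductionAtPrime p → a = -1) →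
        IsMultPAdicLFunctionOf f p a L →
        ∃ n : ℕ, ‖PowerSeries.coeff n (PowerSeries.C ((ϖ : ℚ) : ℚ_[p]) * L)‖ = 1)
    (hS : ∀ (W : WeierstrassCurve ℚ) [W.IsElliptic] [W.IsGloballyMinimal] (p : ℕ) [Fact p.Prime],
      ClassX11a W p → 5 ≤ p → Surj W p → ¬ X11a.ShaAnUnit W p → X11a.MuAnZeroAt W p)
    (hMC3 : ∀ (W : WeierstrassCurve ℚ) [W.IsElliptic] [W.IsGloballyMinimal] (p : ℕ) [Fact p.Prime],
      ClassX11a W p → p = 3 → ¬ X11a.ShaAnUnit W p → ¬ p ∣ padicValInt p W.minimalDiscriminantInt →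
      X2.MazurMainConjectureAt W p) :
    Summit.BirchSwinnertonDyer.BirchSwinnertonDyer.Theses.ErratumRoadFive.X11aLowerHalf :=
  x11aLowerHalf_of_children_r16K h9 h9L hQ3 h48D hS hMC3

/-! ### §4 Monotonicity (no road lost): r15's texts ⟹ the r16 texts -/

/-- **r15's fourth child (item 19948's text, verbatim) ⟹ r16-K's deep-restricted fourth text** (drop the `¬ X11a.ShaAnUnit` binder; pure
logic).  With the tree's `muAnDeepFive_of_nonSurjCornerTwinMuAn_of_surjDeep` (r15's fourth + fifth ⟹ r16-M's certificate, modulo BDMTV) this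
makes both re-cuts MONOTONE: every proof of the r15 texts closes the r16 texts.  [cite: GreenbergLNM1716, §1 Conj. 1.11 (p. 61)]
[cite: MazurTateTeitelbaum1986Invent, §I.10 and §I.14 (shape only)] -/
theorem nonSurjTwinMuAnDeep_of_nonSurjCornerTwinMuAn
    (h48 : Summit.BirchSwinnertonDyer.BirchSwinnertonDyer.Theses.ErratumRoadFive.NonSurjCornerTwinMuAn) :
    ∀ (Wd : WeierstrassCurve ℚ) [Wd.IsElliptic] [Wd.IsGloballyMinimal] (p : ℕ) [Fact p.Prime],
      ClassX11a Wd p → ¬ Surj Wd p → (p = 5 ∨ p = 7) → p ∣ padicValInt p Wd.minimalDiscriminantInt →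
      ¬ X11a.ShaAnUnit Wd p →
      ∀ {N : ℕ} [NeZero N] (f : CuspForm (Gamma0 N) 2), IsNewformOf Wd f →
      ∀ (ϖ : ℚ), (ϖ : ℝ) * Wd.realPeriodRat = plusPeriod f →
      ∀ (a : ℚ_[p]) (L : PowerSeries ℚ_[p]),
        (Wd.HasSplitMultiplicativeReductionAtPrime p → a = 1) →
        (¬ Wd.HasSplitMultiplicativeReductionAtPrime p → a = -1) →
        IsMultPAdicLFunctionOf f p a L →
        ∃ n : ℕ, ‖PowerSeries.coeff n (PowerSeries.C ((ϖ : ℚ) : ℚ_[p]) * L)‖ = 1 :=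
  fun Wd _ _ p _ hX hs h57 hdvd _ => h48 Wd p hX hs h57 hdvd

/-- **The certificate `X11a.MuAnZeroAt W p` back in the allowable-root currency** (fact-free converse of the tree's
`NonSurjChain.muAnZeroAt_of_allowableRootShape`): at a split `p` the allowable root is `a = 1` and `IsMultPAdicLFunctionOf f p 1 L ↔
IsSplitMultPAdicLFunctionOf f p L` (`isMultPAdicLFunctionOf_one_iff`); at a non-split `p`, `a = -1`.  So the two currencies are EQUIVALENT
per pair. [cite: MazurTateTeitelbaum1986Invent, §I.10 and §I.14 (allowable root a_p at p ∥ N; shape only)] [cite: GreenbergLNM1716, §1 Conj. 1.11 (p. 61)] -/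
theorem allowableRootShape_of_muAnZeroAt {W : WeierstrassCurve ℚ} [W.IsElliptic] [W.IsGloballyMinimal] {p : ℕ} [Fact p.Prime]
    (h : X11a.MuAnZeroAt W p) :
    ∀ {N : ℕ} [NeZero N] (f : CuspForm (Gamma0 N) 2), IsNewformOf W f →
      ∀ (ϖ : ℚ), (ϖ : ℝ) * W.realPeriodRat = plusPeriod f →
      ∀ (a : ℚ_[p]) (L : PowerSeries ℚ_[p]),
        (W.HasSplitMultiplicativeReductionAtPrime p → a = 1) →
        (¬ W.HasSplitMultiplicativeReductionAtPrime p → a = -1) →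
        IsMultPAdicLFunctionOf f p a L →
        ∃ n : ℕ, ‖PowerSeries.coeff n (PowerSeries.C ((ϖ : ℚ) : ℚ_[p]) * L)‖ = 1 := by
  intro N _ f hf ϖ hϖ a L hsa hna hL
  obtain ⟨hn, hs⟩ := h f hf ϖ hϖ
  by_cases hsp : W.HasSplitMultiplicativeReductionAtPrime p
  · have ha : a = 1 := hsa hsp
    subst ha
    exact hs hsp L ((isMultPAdicLFunctionOf_one_iff L).mp hL)
  · have ha : a = -1 := hna hsp
    subst ha
    exact hn hsp L hL

/-- **r16-M's single certificate child ⟹ r16-K's deep-restricted fourth text** (pure logic, the converse adapter): so r16-K's fourth +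
fifth texts and r16-M's one text are EQUIVALENT modulo BDMTV (`muAnDeepFive_of_twinMuAnDeep_of_surjDeep` the other way) — the choice between the
two re-cuts is a choice of DISPLAY (two named open statements cut by the image of `ρ̄`, or one), not of content.
[cite: GreenbergLNM1716, §1 Conj. 1.11 (p. 61)] [cite: MazurTateTeitelbaum1986Invent, §I.10 and §I.14 (shape only)] -/
theorem nonSurjTwinMuAnDeep_of_muAnDeepFive
    (hμ5 : ∀ (W : WeierstrassCurve ℚ) [W.IsElliptic] [W.IsGloballyMinimal] (p : ℕ) [Fact p.Prime],
      ClassX11a W p → 5 ≤ p → ¬ X11a.ShaAnUnit W p → X11a.MuAnZeroAt W p) :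
    ∀ (Wd : WeierstrassCurve ℚ) [Wd.IsElliptic] [Wd.IsGloballyMinimal] (p : ℕ) [Fact p.Prime],
      ClassX11a Wd p → ¬ Surj Wd p → (p = 5 ∨ p = 7) → p ∣ padicValInt p Wd.minimalDiscriminantInt →
      ¬ X11a.ShaAnUnit Wd p →
      ∀ {N : ℕ} [NeZero N] (f : CuspForm (Gamma0 N) 2), IsNewformOf Wd f →
      ∀ (ϖ : ℚ), (ϖ : ℝ) * Wd.realPeriodRat = plusPeriod f →
      ∀ (a : ℚ_[p]) (L : PowerSeries ℚ_[p]),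
        (Wd.HasSplitMultiplicativeReductionAtPrime p → a = 1) →
        (¬ Wd.HasSplitMultiplicativeReductionAtPrime p → a = -1) →
        IsMultPAdicLFunctionOf f p a L →
        ∃ n : ℕ, ‖PowerSeries.coeff n (PowerSeries.C ((ϖ : ℚ) : ℚ_[p]) * L)‖ = 1 := by
  intro Wd _ _ p _ hX _ h57 _ hu N _ f hf ϖ hϖ a L hsa hna hL
  have hp5 : 5 ≤ p := by rcases h57 with rfl | rfl <;> omega
  exact allowableRootShape_of_muAnZeroAt (hμ5 Wd p hX hp5 hu) f hf ϖ hϖ a L hsa hna hL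

/-- **r15's nine chain facts ⟹ r16-M's eight** (projection; BDMTV Thm. 1.2 is conjunct 9 of r15's `stub_chainFactsLower` and is not consumed by
the merged road).  With it, r15's six binders give the crux through r16-M: `x11aLowerHalf_of_children_r16 h9 (chainEight_of_chainNine h9L) hQ3
(muAnDeepFive_of_nonSurjCornerTwinMuAn_of_surjDeep h9L.2.2.2.2.2.2.2.2 h48 hS) hMC3` (statement = p646859's r15, not re-landed).
[cite: BalakrishnanEtAl2019, §1 Thm. 1.2] [cite: EmertonPollackWeston2006, Thm. 3.1.1, Thm. 1, Thm. 5.1.3] -/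
theorem chainEight_of_chainNine
    (h9L : thm311_cotorsion_weightK_member_ofLevel_odd ∧ thm1_muAlg_of_weightK_member_ofLevel_odd ∧
      Wan2015.thm4_rational_weightK_member_of_bdd_ofLevel_irred ∧
      thm513_transfer_from_weightK_member_of_bdd_ofLevel_odd ∧
      DeligneSerre1974.thm61_exists_adicGaloisRep ∧ Hida2000_thm326_ordinary ∧
      kato_charIdeal_dvd_multiplicative_of_surjective ∧
      rank_eq_analyticRank_of_analyticRank_le_one ∧
      thm12_not_le_normalizer_splitCartan) :
    thm311_cotorsion_weightK_member_ofLevel_odd ∧ thm1_muAlg_of_weightK_member_ofLevel_odd ∧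
      Wan2015.thm4_rational_weightK_member_of_bdd_ofLevel_irred ∧
      thm513_transfer_from_weightK_member_of_bdd_ofLevel_odd ∧
      DeligneSerre1974.thm61_exists_adicGaloisRep ∧ Hida2000_thm326_ordinary ∧
      kato_charIdeal_dvd_multiplicative_of_surjective ∧
      rank_eq_analyticRank_of_analyticRank_le_one :=
  ⟨h9L.1, h9L.2.1, h9L.2.2.1, h9L.2.2.2.1, h9L.2.2.2.2.1, h9L.2.2.2.2.2.1, h9L.2.2.2.2.2.2.1, h9L.2.2.2.2.2.2.2.1⟩

end Summit.BirchSwinnertonDyer.BirchSwinnertonDyer.Theorems.Birth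

end
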